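/-
Copyright (c) 2026. All rights reserved.
Released under Apache 2.0 license as described in the file LICENSE.
Authors: abc-iut cell, cone prover seat abc-iut-w6-d028 (wave W6, tranche 1).
-/
import Literature.AnabelianGeometry.AbsoluteAnabelian.LogFrobeniusTwistProofs
import HarnessLib

/-!
# [AbsTopIII] Definition 5.4 (iii)–(vi): the vertex census of `Γ⃗^log_v` and `Γ⃗^×_v` — proofs

S. Mochizuki, *Topics in absolute anabelian geometry III: global reconstruction algorithms*,
J. Math. Sci. Univ. Tokyo 22 (2015) 939–1156 [MochizukiAbsTopIII2015]; locators `p.N` = pages of the author's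
manuscript (`paper:url-5493eb38cbb7`): Def 5.4 (iii) p. 126, (iv) pp. 126–127, (v) p. 127, (vi) p. 128;
Cor 5.5 p. 130 ("subject to the proviso that we identify the functors associated to the space-link and post-log
vertices").

PROOF-ONLY companion (no `def`, nothing restated) of `LogFrobeniusGraphs.lean` / `LogFrobeniusCompatibility.lean`
(statement typer abc-iut-L4-t3, p405623; DEFS-FROZEN); the post-log half of the bookkeeping
(`LogVertex.isPostLog_eq_true_iff`, `LogVertex.spaceLink_ne_postLog`, the twist `Λ_ν`) is `LogFrobeniusTwistProofs.lean`
(abc-iut-w6-d031, p427912), imported and used BY NAME.  Def 5.4 (iv) [resp. (vi)] constructs the functor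
`λ⊞_{v,ν}` FIRST "for each vertex `ν` of `Γ⃗^×_v`" and THEN "if `ν` is either the space-link or the post-log vertex
of `Γ⃗^log_v`", and concludes "Thus, in summary, we obtain natural functors `λ⊞_{v,ν}`, `λ_{v,ν}` … for each
vertex `ν` of `Γ⃗^log_v`" (p. 127 l. 31–36; p. 128).  The summary rests on the bookkeeping fact that the vertices of
`Γ⃗^log_v` are exactly the vertices of `Γ⃗^×_v := Γ⃗^⋉_v ∩ Γ⃗^⋊_v` together with the space-link and the post-log
vertex, the latter two being distinct and not in `Γ⃗^×_v`.  The typed interface encodes "vertex of `Γ⃗^×_v`" by the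
Boolean predicate `LogVertex.IsCross` and "the arrows of `Γ⃗^×_v`" by `NonarchEdge.InCore` / `ArchEdge.InCore`
(the arrows surviving the removal of `k̄^× ↪ k̄` and of `k~ →(id) k~`).  This file proves, by finite case analysis:

* the trichotomy `LogVertex.isCross_or_eq` (every vertex of `Γ⃗^log_v` is a cross vertex, the space-link vertex or
  the post-log vertex) and its sharpness (`not_isCross_spaceLink`, `not_isCross_postLog`, `isCross_iff_ne`,
  `not_isCross_iff`);
* the explicit list of the four cross vertices of `Γ⃗^log_non` (`LogVertex.isCross_nonarch_iff`) and that the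
  Boolean encoding agrees with the edge-defined subgraph of print: a vertex is cross iff it is an endpoint of an
  arrow of `Γ⃗^×_v` (`LogVertex.isCross_nonarch_iff_endpoint_inCore`; the archimedean half is abc-iut-w6-d030's
  `LogVertex.isCross_arch_iff_endpoint_inCore`, `LogFrobeniusLambdaFunctorsProofs.lean`);
* the consequence used by Cor 5.5 (rows 3–4 of `D•`, p. 130): in a `LogFrobeniusSetting`, the family
  `λ⊞_v = {λ⊞_{v,ν}}_ν` takes, at every non-cross vertex, the single value `λ⊞_{v,post-log}`
  (`LogFrobeniusSetting.lam_eq_lam_postLog_of_not_isCross`), so that it is determined by its values at the cross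
  vertices and at the post-log vertex.

Refereed pre-IUT anabelian geometry; nothing here bears on [IUTchIII] Cor. 3.12; typed ≠ proved.
-/

set_option autoImplicit false

universe u

open CategoryTheory

namespace Literature.AnabelianGeometry.AbsoluteAnabelian

namespace LogVertex

/-- `isSpaceLink` reflects equality with the space-link vertex. [cite: MochizukiAbsTopIII2015, Def 5.4 (iv) p. 127] -/
theorem isSpaceLink_eq_true_iff : ∀ {b : Bool} (ν : LogVertex b), ν.isSpaceLink = true ↔ ν = spaceLink b
  | true, ν => by
    show decide (@Eq ArchVertex ν ArchVertex.spaceLink) = true ↔ @Eq ArchVertex ν ArchVertex.spaceLink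
    exact decide_eq_true_iff
  | false, ν => by
    show decide (@Eq NonarchVertex ν NonarchVertex.spaceLink) = true ↔ @Eq NonarchVertex ν NonarchVertex.spaceLink
    exact decide_eq_true_iff

/-- a vertex of `Γ⃗^log_v` is a vertex of `Γ⃗^×_v` iff it is neither the post-log nor the space-link vertex.
[cite: MochizukiAbsTopIII2015, Def 5.4 (iv) p. 127] -/
theorem isCross_iff_ne {b : Bool} (ν : LogVertex b) : ν.IsCross ↔ ν ≠ postLog b ∧ ν ≠ spaceLink b := by
  rw [IsCross, ne_eq, ne_eq, ← isPostLog_eq_true_iff, ← isSpaceLink_eq_true_iff, Bool.not_eq_true,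
    Bool.not_eq_true]

/-- the space-link vertex is not a vertex of `Γ⃗^×_v`. [cite: MochizukiAbsTopIII2015, Def 5.4 (iv) p. 127] -/
theorem not_isCross_spaceLink (b : Bool) : ¬ (spaceLink b).IsCross := fun h =>
  ((isCross_iff_ne _).1 h).2 rfl

/-- the post-log vertex is not a vertex of `Γ⃗^×_v`. [cite: MochizukiAbsTopIII2015, Def 5.4 (iv) p. 127] -/
theorem not_isCross_postLog (b : Bool) : ¬ (postLog b).IsCross := fun h =>
  ((isCross_iff_ne _).1 h).1 rfl

/-- VERTEX CENSUS ("Thus, in summary, we obtain natural functors … for each vertex `ν` of `Γ⃗^log_v`"): every vertex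
of `Γ⃗^log_v` is a vertex of `Γ⃗^×_v`, or the space-link vertex, or the post-log vertex.
[cite: MochizukiAbsTopIII2015, Def 5.4 (iv) p. 127] -/
theorem isCross_or_eq {b : Bool} (ν : LogVertex b) : ν.IsCross ∨ ν = spaceLink b ∨ ν = postLog b := by
  by_cases h₁ : ν = spaceLink b
  · exact Or.inr (Or.inl h₁)
  by_cases h₂ : ν = postLog b
  · exact Or.inr (Or.inr h₂)
  exact Or.inl ((isCross_iff_ne ν).2 ⟨h₂, h₁⟩)

/-- the census as a partition: a vertex of `Γ⃗^log_v` fails to be a cross vertex iff it is the space-link or the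
post-log vertex. [cite: MochizukiAbsTopIII2015, Def 5.4 (iv) p. 127] -/
theorem not_isCross_iff {b : Bool} (ν : LogVertex b) : ¬ ν.IsCross ↔ ν = spaceLink b ∨ ν = postLog b := by
  constructor
  · intro h
    rcases isCross_or_eq ν with h' | h' | h'
    · exact (h h').elim
    · exact Or.inl h'
    · exact Or.inr h'
  · rintro (rfl | rfl)
    · exact not_isCross_spaceLink b
    · exact not_isCross_postLog b

end LogVertex

/-- Def 5.4 (iv): for `v ∈ V^non` the vertices "`ν` of `Γ⃗^×_v`" indexing the first construction of `λ⊞_{v,ν}` — in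
the typing's reading `LogVertex.IsCross` — are exactly `𝒪^×_k̄` (`units`), `k̄^×` (`mult`), the codomain `k~` of the
shell-arrow (`shellCod`) and `(k̄^×)^pf` (`perf`): the four vertices of the diagram of Def 5.4 (iii) other than the
space-link vertex `k̄` and the post-log vertex. [cite: MochizukiAbsTopIII2015, Def 5.4 (iv) p. 127] -/
theorem LogVertex.isCross_nonarch_iff (ν : NonarchVertex) :
    LogVertex.IsCross (b := false) ν ↔ (ν = .units ∨ ν = .mult ∨ ν = .shellCod ∨ ν = .perf) := by
  cases ν <;> simp [LogVertex.IsCross, LogVertex.isPostLog, LogVertex.isSpaceLink, NonarchVertex.IsPostLog]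

/-- Def 5.4 (iii)/(iv), coherence of the two frozen encodings: `Γ⃗^×_non` is "the intersection of `Γ⃗^⋉_non`,
`Γ⃗^⋊_non`" (the subgraphs obtained by removing `k̄^× ↪ k̄`, resp. `k~ →(id) k~`), and a vertex of `Γ⃗^log_non` is a
vertex "of `Γ⃗^×_v`" in the sense used by (iv) (`LogVertex.IsCross`) iff it is an endpoint of an arrow of that
intersection (`NonarchEdge.InCore`).  Archimedean twin: `LogVertex.isCross_arch_iff_endpoint_inCore`
(`LogFrobeniusLambdaFunctorsProofs.lean`). [cite: MochizukiAbsTopIII2015, Def 5.4 (iv) p. 127] -/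
theorem LogVertex.isCross_nonarch_iff_endpoint_inCore (ν : NonarchVertex) :
    LogVertex.IsCross (b := false) ν ↔
      ∃ (a c : NonarchVertex) (e : NonarchEdge a c), e.InCore ∧ (ν = a ∨ ν = c) := by
  constructor
  · intro h
    cases ν
    · exact ⟨_, _, .unitsToMult, NonarchEdge.inCore_of_ne.1, Or.inl rfl⟩
    · exact ⟨_, _, .unitsToMult, NonarchEdge.inCore_of_ne.1, Or.inr rfl⟩
    · exact absurd h.2 (by decide)
    · exact absurd h.1 (by decide)
    · exact ⟨_, _, .shell, NonarchEdge.inCore_shell, Or.inr rfl⟩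
    · exact ⟨_, _, .multToPerf, NonarchEdge.inCore_of_ne.2.1, Or.inr rfl⟩
  · rintro ⟨a, c, e, he, h⟩
    cases e <;> rcases h with rfl | rfl <;>
      first
        | exact ⟨rfl, rfl⟩
        | exact (NonarchEdge.not_inCore.1 he).elim
        | exact (NonarchEdge.not_inCore.2 he).elim

namespace LogFrobeniusSetting

variable {Vmod : Type u} {isArc : Vmod → Bool} (S : LogFrobeniusSetting Vmod isArc)

/-- Cor 5.5's proviso made effective: at every vertex of `Γ⃗^log_v` outside `Γ⃗^×_v` the functor `λ⊞_{v,ν}` is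
`λ⊞_{v,post-log}` (the space-link and post-log functors being identified, both assigning "the underlying additive
topological group of the field `k`"). [cite: MochizukiAbsTopIII2015, Def 5.4 (iv) p. 127] -/
theorem lam_eq_lam_postLog_of_not_isCross (v : Vmod) (ν : LogVertex (isArc v)) (hν : ¬ ν.IsCross) :
    S.lam v ν = S.lam v (LogVertex.postLog (isArc v)) := by
  rcases (LogVertex.not_isCross_iff ν).1 hν with rfl | rfl
  · exact S.lam_spaceLink_eq_postLog v
  · rfl

end LogFrobeniusSetting

end Literature.AnabelianGeometry.AbsoluteAnabelian
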